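import Literature.NumberTheory.EllipticCurves.SelmerCorankControl
import HarnessLib

/-!
# Even-length `T`-blocks of `X(E/ℚ_∞)` occur with even multiplicity (Howard 2004, Cor. 5.3)

Topic `NumberTheory/EllipticCurves` (family `bsd`); named fact requested by work item `wi-100508`
(consumer: the hypothesis `hH : ∃ m, derivedLength p D.X 1 = derivedLength p D.X 2 + 2m` of
`Summit.BirchSwinnertonDyer.BirchSwinnertonDyer.Theorems.DerivedCoinvariantProfileAtPoint.{lengthAt_ne_derivedLength_zero_add_one_of_even_blocks_two,
lengthAt_eq_two_or_four_le_of_even_blocks_two, order_eq_two_or_four_le_of_MCT_of_even_blocks_two}`).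

## Source (held text `paper:arxiv-1202.6343`, B. Howard, *Derived `p`-adic heights and `p`-adic
`L`-functions*, Amer. J. Math. **126** (2004) 1315–1340; locators `pNNNN:Lnn` are chunk:line of the
materialised arXiv text)

Standing data [§1, p0003:L3, L20–L28]: "Fix forever a rational prime `p > 2`"; `F` a number field,
`F_∞/F` a `ℤ_p`-extension, `Γ = Gal(F_∞/F)`, `γ ∈ Γ` a topological generator; [§5, p0012:L3–L12]:
`Λ = ℤ_p[[Gal(F_∞/F)]]`, `J` its augmentation ideal (so `J = (γ - 1) = (T)` under `Λ ≅ ℤ_p⟦T⟧`,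
`T = γ - 1`), `A/F` an abelian variety with "good ordinary reduction at all primes of `F` above `p`,
the primes of bad reduction are finitely decomposed in `F_∞`, `p` does not ramify in `F`, and all
primes of `F` above `p` do ramify in `F_∞`"; [p0012:L32–L36]: `Y = Sel_{p^∞}(A/F_∞)`,
`X = Hom_{ℤ_p}(Y, ℚ_p/ℤ_p)`, "cofinitely and finitely generated `Λ`-modules, respectively".
[Thm. 5.2, p0012:L119–L142]: a filtration `… ⊂ S_p^{(2)}(A/F) ⊂ S_p^{(1)}(A/F) = S_p(A/F) ⊗ ℚ_p` with
`dim_{ℚ_p} S_p^{(r)}(A/F) = rank(J^{r-1}X/J^rX)`, pairings `h^{(r)} : S_p^{(r)}(A/F) × S_p^{(r)}(A^∨/F) → W_r`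
with left/right kernels `S_p^{(r+1)}`, and, for a polarization `φ`,
`h^{(r)}(a, φ(b)) = (-1)^{r+1} h^{(r)}(b, φ(a))`. [p0012:L168–p0013:L6]: "By the structure theorem for
finitely-generated Iwasawa modules, we may fix a pseudo-isomorphism of `Λ`-modules
`X ∼ Λ^{e_∞} ⊕ M ⊕ M'` such that `M'` is a torsion `Λ`-module with characteristic ideal prime to `J`,
and `M` has the form `M ≅ (Λ/J)^{e_1} ⊕ (Λ/J²)^{e_2} ⊕ …`."
**Corollary 5.3** [p0013:L11–L21]: "The integers `e_i` satisfy the following properties: • the height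
pairing `h^{(1)}` is nondegenerate if and only if `e_i = 0` for `1 < i ≤ ∞`, • `e_∞ = dim S_p^{(∞)}(A/F)`,
• `e_r = dim_{ℚ_p}(S_p^{(r)}(A/F)/S_p^{(r+1)}(A/F))`, • **`e_r ≡ 0 (mod 2)` when `r` is even**."
Proof in print [p0013:L23–L38]: `dim S_p^{(r)} = rank(J^{r-1}X/J^rX) = e_r + e_{r+1} + ⋯ + e_∞`; a
polarization identifies `S_p^{(r)}(A/F) ≅ S_p^{(r)}(A^∨/F)` and makes `h^{(r)}` an alternating form on
`S_p^{(r)}` with kernel `S_p^{(r+1)}` for `r` even, so `S_p^{(r)}/S_p^{(r+1)}` is even-dimensional.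
(The first bullet is due to Perrin-Riou [p0013:L8]; the derived heights originate with
Bertolini–Darmon, Amer. J. Math. 117 (1995), §2.) [p0013:L40–L45]: for `F_∞` cyclotomic, `F = ℚ`
and `A` modular, `e_∞ = 0` by Kato, "but it is not known that `e_i = 0` for `i > 1`".

## What is typed, and how it reads the printed statement

**`Howard2004_evenBlockMultiplicity_rat`** (named fact, NOT discharged: the proof needs the
derived `p`-adic height pairings of §§2–5, absent from Mathlib and the tree): the last bullet of
Cor. 5.3 in the case the consumer needs — `F = ℚ`, `A = E` an elliptic curve (globally minimal
model `W`), `F_∞ = ℚ_∞` the cyclotomic `ℤ_p`-extension (`κ.IsCyclotomic`, topological generator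
`γ`, `κ.IsTopGenerator γ`), `p` odd of good ordinary reduction (`W.HasGoodReductionAtPrime p`,
`p ∤ a_p(W)`, i.e. `Literature.IsOrdinaryAt W p` of file `PAdicLFunction`, spelled out as in
`Greenberg1999_coinvariantsRank_eq_selmerCorank_rat` to keep the imports small), `X = D.X` for a
Pontryagin-dual datum `D : W.SelmerDualData κ γ` (file `IwasawaSelmer`: `X ≅ Hom(Sel_{p^∞}(E/ℚ_∞), ℚ_p/ℤ_p)`
with `T` acting as `γ - 1`, unique up to unique `Λ`-isomorphism). For `F = ℚ` Howard's remaining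
standing hypotheses hold automatically: `p` is unramified in `ℚ`, `p` is (totally) ramified in
`ℚ_∞`, and every prime is finitely decomposed in `ℚ_∞/ℚ`.

The multiplicities `e_r` are expressed WITHOUT choosing a pseudo-isomorphism, through the
tree's endomorphism `mulTRat p X` (= `T` on `V = ℚ_p ⊗_{ℤ_p} X`, file `SelmerCorankControl`): put
`d_k = dim_{ℚ_p} ker(T^k : V → V)`. Since `ℚ_p ⊗_{ℤ_p} -` is exact and kills finite modules, the fixed
pseudo-isomorphism gives `V ≅ ℚ_p ⊗ Λ^{e_∞} ⊕ ⊕_i (ℚ_p[T]/T^i)^{e_i} ⊕ ℚ_p ⊗ M'`; `T` is injective on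
the first summand (`Λ[1/p]` is a domain) and invertible on the last
(`ℚ_p ⊗ M' ≅ ⊕_j ℚ_p[T]/(f_j^{a_j})` over the distinguished `f_j` with `(f_j) ≠ (T)` of `char(M')`, the
summands `Λ/p^m` dying), so `d_k = ∑_i e_i · min(i, k)` (finite), `d_k - d_{k-1} = ∑_{i ≥ k} e_i`, and
**`e_r = 2 d_r - d_{r-1} - d_{r+1}`** for every `r ≥ 1`. The typed statement is therefore, for every
`j : ℕ` (even `r = 2j + 2 ≥ 2`): `∃ m, 2·d_{2j+2} = d_{2j+1} + d_{2j+3} + 2m`, i.e. `e_{2j+2}` is even —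
exactly the printed "`e_r ≡ 0 (mod 2)` when `r` is even". In the consumer's notation
(`derivedLength p X i = ℓ_{(T)}(T^iX/T^{i+1}X) = dim S_p^{(i+1)} = ∑_{k ≥ i+1} e_k + e_∞`) this is
`derivedLength (2j+1) - derivedLength (2j+2) ∈ 2ℕ`; the translation is module theory on the
consumer's (Summit) side.

Faithfulness ∕ scope: the statement is the special case `(F, A, F_∞) = (ℚ, E, ℚ_∞^{cyc})` of the
printed corollary, with no hypothesis dropped (`p > 2`, good ordinary at `p`) and nothing added; it
asserts nothing about `e_∞`, `e_1` or non-degeneracy of `h^{(1)}` (conjectural, [p0013:L40–L45]), and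
nothing towards BSD. Grade: REFEREED (Amer. J. Math. 126 (2004); arXiv:1202.6343).
-- TODO(general form): Howard proves Cor. 5.3 for an abelian variety `A` over a number field `F` and
-- any `ℤ_p`-extension `F_∞/F` under the four hypotheses of §4 quoted above; the tree has Selmer
-- duals only for elliptic curves (`SelmerDualData`), and no predicate yet for "finitely decomposed
-- in `K_∞`" ∕ "`p` unramified in `K`", so only the case over `ℚ` is recorded.

## References

* [Howard2004DerivedHeights] B. Howard, *Derived p-adic heights and p-adic L-functions*, Amer. J.
  Math. 126 (2004), 1315–1340 (arXiv:1202.6343), Thm. 5.2, Cor. 5.3.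
* [BertoliniDarmon1995] M. Bertolini, H. Darmon, *Derived p-adic heights*, Amer. J. Math. 117 (1995),
  §2 (origin of the derived heights; not used in the statement).
-/

namespace Literature.NumberTheory.EllipticCurves

section Facts

open IwasawaAlgebra

/-- **Howard (2004), Cor. 5.3, last bullet, for `E/ℚ` and the cyclotomic `ℤ_p`-extension** (named
fact). Let `p > 2` be a prime, `E/ℚ` an elliptic curve with globally minimal model `W` having good
ordinary reduction at `p` (`W.HasGoodReductionAtPrime p`, `p ∤ a_p(W)`), `ℚ_∞/ℚ` the cyclotomic
`ℤ_p`-extension (`hκ`) with topological generator `γ` (`hγ`), and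
`X = X(E/ℚ_∞) = Hom(Sel_{p^∞}(E/ℚ_∞), ℚ_p/ℤ_p)` the Iwasawa module of `D` (`T = γ - 1`,
`J = (T)`). Fix a pseudo-isomorphism `X ∼ Λ^{e_∞} ⊕ ⊕_{i ≥ 1} (Λ/J^i)^{e_i} ⊕ M'` with `char(M')`
prime to `J`. Then "`e_r ≡ 0 (mod 2)` when `r` is even" (the `r`-th derived `p`-adic height is an
alternating form on `S_p^{(r)}(E/ℚ)` with kernel `S_p^{(r+1)}`, and `e_r = dim S_p^{(r)}/S_p^{(r+1)}`).
Here `e_r` is written invariantly as `2 d_r - d_{r-1} - d_{r+1}` with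
`d_k = dim_{ℚ_p} ker(T^k | ℚ_p ⊗_{ℤ_p} X)` (`mulTRat`; `d_k = ∑_i e_i min(i,k)`, see the module
docstring), and `r = 2j + 2` runs over the even integers `≥ 2`:
`∀ j, ∃ m, 2 d_{2j+2} = d_{2j+1} + d_{2j+3} + 2m` (powers in `Module.End ℚ_[p] _`; at `j = 0`
unfold with `pow_one`, `pow_two`, `pow_succ`, `Module.End.mul_eq_comp` to the tree's composite
spelling `mulTRat ∘ₗ mulTRat` of `T²`).
Howard (2004), Thm. 5.2 and Cor. 5.3 (arXiv:1202.6343, pp. 12–13; held text p0012:L119–L142,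
p0012:L168–p0013:L21). [cite: Howard2004DerivedHeights, Thm. 5.2 and Cor. 5.3] -/
def Howard2004_evenBlockMultiplicity_rat : Prop :=
  ∀ (W : WeierstrassCurve ℚ) [W.IsElliptic] [W.IsGloballyMinimal] (p : ℕ) [Fact p.Prime]
    (_hp : p ≠ 2) (_hgood : W.HasGoodReductionAtPrime p) (_hord : ¬ (p : ℤ) ∣ W.frobeniusTrace p)
    (κ : ZpExtension ℚ p) (γ : Field.absoluteGaloisGroup ℚ)
    (_hκ : κ.IsCyclotomic) (_hγ : κ.IsTopGenerator γ) (D : W.SelmerDualData κ γ) (j : ℕ),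
    ∃ m : ℕ,
      2 * Module.finrank ℚ_[p] (LinearMap.ker (mulTRat p D.X ^ (2 * j + 2))) =
        Module.finrank ℚ_[p] (LinearMap.ker (mulTRat p D.X ^ (2 * j + 1))) +
          Module.finrank ℚ_[p] (LinearMap.ker (mulTRat p D.X ^ (2 * j + 3))) + 2 * m

end Facts

end Literature.NumberTheory.EllipticCurves
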